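import Summits.ResolutionOfSingularities.ResolutionOfSingularities.Theorems.FrobeniusClosingPatchingRelPerfectMonomialRouteKAtlas
import Literature.AlgebraicGeometry.Resolution.KollarBlowupSequenceFunctorsProofs
import Literature.AlgebraicGeometry.Resolution.KollarFunctorLinearCentre
import Literature.AlgebraicGeometry.Resolution.IdealSheafLemmas
import HarnessLib

/-!
# Crux `PatchingRelPerfect` (stmt-ResolutionOfSingularities-16161), chain w52 — TargetsF3 (m)
# «M2-strong», COMBINATORIAL HALF, Route K step K17: LEVEL ZERO — the affine space `𝔸^{B₀}_ℚ` of a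
# simplex state with Kollár's functorial order reduction satisfies the invariant

[OURS · L1 W5.2 · design memo v3 (`L/res-type-075/M2STRONG-COMBINATORIAL-HALF.md`); fact-free;
nothing here is a statement of the manuscript under review]

For a well-formed state `s` all of whose index subsets are strata (file K6 reduced the target to this
case), the toric model is the affine space `Y₀ = Spec ℚ[x_b : b ∈ s.B]` with the boundary hyperplanes
`D_b = V(x_b)` and the monomial ideal `I = (x^α : α ∈ s.A)`.  `(Y₀, I, ∅)` is a triple of Kollár's
Notation 3.64 (`triple₀`), the tree's PROVED functorial order reduction in characteristic zero
(`Kollar2007Thm3_103.orderReduction Kollar2007Thm3_103_holds Kollar2007Thm3_107_holds`, Kollár 2007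
Thms. 3.103/3.107 with 3.70) provides for each marking `m ≥ 1` a blow-up sequence functor whose value
`𝔰` on it resolves `(I, m)` and commutes with smooth morphisms, in particular with the torus scalings
(file K3(a)'s `scale`), along which `(Y₀, I, ∅)` is its own pull-back (`isPullbackAlong_scale₀`), so `𝔰`
is its own pull-back (`selfPullback₀`).  With the single chart `(⊤, Γ(Y₀, ⊤) ≅ ℚ[x], id)` this is the
invariant `Good` of file K9 at level zero: **`good_levelZero`**.
-/

-- `Summit.<Summit>.<Sub>.Theorems` with `Sub = Summit` (single-conjunct summit, D-0017)
set_option linter.dupNamespace false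

noncomputable section

open CategoryTheory AlgebraicGeometry TopologicalSpace MvPolynomial
open Literature.AlgebraicGeometry.Resolution

namespace Summit.ResolutionOfSingularities.ResolutionOfSingularities.Theorems

namespace PolyhedraGame

namespace RouteK

/-! ## The triple `(𝔸^{B}_ℚ, (x^α : α ∈ A), ∅)` -/

section Triple

variable (s : State)

/-- [OURS] The structure morphism `𝔸^B_ℚ → Spec ℚ`. -/
def struct₀ : affine s.B ⟶ Spec (.of ℚ) := Spec.map (CommRingCat.ofHom (algebraMap ℚ (R s.B)))

/-- [OURS] The structure morphism is locally of finite type. -/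
instance locallyOfFiniteType_struct₀ : LocallyOfFiniteType (struct₀ s) := by
  unfold struct₀
  rw [HasRingHomProperty.Spec_iff (P := @LocallyOfFiniteType), CommRingCat.hom_ofHom]
  exact RingHom.finiteType_algebraMap.mpr inferInstance

/-- [OURS] The monomial ideal sheaf on `𝔸^B`. -/
def ideal₀ : (affine s.B).IdealSheafData := affineBlowup.idealSheaf (genIdeal s)

/-- [OURS] `𝔸^B_ℚ` is regular. -/
theorem isRegular_affine : Scheme.IsRegular (affine s.B) := by
  haveI : IsRegularRing (CommRingCat.of (R s.B)) := inferInstanceAs (IsRegularRing (R s.B))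
  exact Scheme.isRegular_Spec _

/-- [OURS] `𝔸^B_ℚ` is equidimensional of some dimension. -/
theorem exists_dim₀ : ∃ n : ℕ, ∀ Z ∈ irreducibleComponents (affine s.B), topologicalKrullDim Z = n :=
  exists_equidim_of_isIntegral (struct₀ s)

/-- [OURS] The dimension (a choice; it is `#B`, not needed). -/
def dim₀ : ℕ := Classical.choose (exists_dim₀ s)

variable {s} (hs : s.WF)

/-- [OURS · Route K, K17] **The triple `(𝔸^B_ℚ, (x^α), ∅)` of Kollár's Notation 3.64.** -/
def triple₀ : Kollar2007.Triple ℚ (dim₀ s) :=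
  { X := affine s.B, struct := struct₀ s, isRegular := isRegular_affine s,
    equidim := Classical.choose_spec (exists_dim₀ s), ideal := ideal₀ s,
    stalkIdeal_ne_bot := stalkIdeal_ne_bot_of_ne_bot fun h =>
      genIdeal_ne_bot hs (affineBlowup.idealSheaf_eq_bot_iff.mp h),
    boundary := [],
    hasSNC := hasSNC_nil_of_isRegular (isRegular_affine s), boundary_pairwise := List.Pairwise.nil }

/-- [OURS] Unfolding. -/
@[simp] theorem triple₀_X : (triple₀ hs).X = affine s.B := rfl
/-- [OURS] Unfolding. -/
@[simp] theorem triple₀_ideal : (triple₀ hs).ideal = ideal₀ s := rfl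
/-- [OURS] Unfolding. -/
@[simp] theorem triple₀_boundary : (triple₀ hs).boundary = [] := rfl

/-- [OURS · Route K, K17] **Kollár's functorial order reduction on the triple** (tree, PROVED). -/
theorem exists_functorial_resolution₀ {m : ℕ} (hm : 1 ≤ m) :
    ∃ B : Kollar2007.BlowupSequenceFunctor (dim₀ s),
      (B (triple₀ hs)).IsResolutionOf ((triple₀ hs).marked m) ∧ (B (triple₀ hs)).NoEmptyCentres ∧
      Kollar2007.CommutesWithSmoothMorphisms (Kollar2007.TripleClass.all (dim₀ s)) B := by
  obtain ⟨B, hB, hcomm, -, -⟩ :=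
    (Kollar2007Thm3_103_holds.orderReduction Kollar2007Thm3_107_holds (dim₀ s)).2 m hm
  exact ⟨B, (hB _).1, (hB _).2, hcomm⟩

/-- [OURS] `(𝔸^B, I, ∅)` is its own pull-back along every torus scaling. -/
theorem isPullbackAlong_scale₀ (t : s.B → ℚ) (ht : ∀ b, t b ≠ 0) :
    (triple₀ hs).IsPullbackAlong (triple₀ hs) (scale t ht).hom where
  comp_struct := by
    change (scale t ht).hom ≫ struct₀ s = struct₀ s
    rw [scale_hom', struct₀, ← Spec.map_comp, ← CommRingCat.ofHom_comp]
    congr 2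
    exact RingHom.ext fun a => (scaleHom t).commutes a
  ideal_eq := by
    change ideal₀ s = (ideal₀ s).comap (scale t ht).hom
    rw [ideal₀, scale_hom', affineBlowup.comap_idealSheaf_specMap]
    congr 1
    exact (map_scale_genIdeal s t ht).symm
  boundary_eq := by simp

/-- [OURS · Route K, K17] **The functorial sequence of `(𝔸^B, I, ∅)` is its own pull-back along every torus
scaling.** -/
theorem selfPullback₀ {B' : Kollar2007.BlowupSequenceFunctor (dim₀ s)}
    (hcomm : Kollar2007.CommutesWithSmoothMorphisms (Kollar2007.TripleClass.all (dim₀ s)) B')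
    (t : s.B → ℚ) (ht : ∀ b, t b ≠ 0) :
    CentreSeq.IsPullbackAlong (scale t ht).hom (B' (triple₀ hs)) (B' (triple₀ hs)) := by
  haveI : IsOpenImmersion (scale t ht).hom := IsOpenImmersion.of_isIso _
  haveI : Smooth (scale t ht).hom := SmoothOfRelativeDimension.smooth 0 _
  have hsurj : Surjective (scale t ht).hom := ⟨(scale t ht).hom.homeomorph.surjective⟩
  have h := (@hcomm ℚ _ _ (triple₀ hs) (triple₀ hs) (scale t ht).hom ‹_› trivial trivial
    (isPullbackAlong_scale₀ hs t ht)).1 hsurj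
  conv_rhs => rw [h]
  exact CentreSeq.isPullbackAlong_comap _ _

end Triple

/-! ## The invariant at level zero -/

section LevelZero

variable (s : State)

/-- [OURS] The boundary of `𝔸^B`: the coordinate hyperplanes `V(x_b)`, `b ∈ B` (unit ideal elsewhere). -/
def D₀ (l : ℕ) : (affine s.B).IdealSheafData :=
  if h : l ∈ s.B then affineBlowup.idealSheaf (Ideal.span {(MvPolynomial.X ⟨l, h⟩ : R s.B)}) else ⊤

/-- [OURS] The single toric chart of `𝔸^B`: the whole space, `Γ(𝔸^B, ⊤) ≅ ℚ[x]`, identity labels. -/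
def chart₀ : Chart s.B (affine s.B) where
  lab := id
  U := ⟨⊤, isAffineOpen_top _⟩
  e := (Scheme.ΓSpecIso (CommRingCat.of (R s.B))).commRingCatIsoToRingEquiv

/-- [OURS] The single chart reads the ideal sheaf of an ideal `I ⊆ ℚ[x]` as `I`. -/
theorem chart₀_img_idealSheaf (I : Ideal (R s.B)) : (chart₀ s).img (affineBlowup.idealSheaf I) = I := by
  unfold Chart.img chart₀
  change ((affineBlowup.idealSheaf I).ideal ⟨⊤, isAffineOpen_top _⟩).map _ = I
  rw [affineBlowup.idealSheaf, ideal_ofIdealTop_top, Ideal.map_map]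
  have : ((Scheme.ΓSpecIso (CommRingCat.of (R s.B))).commRingCatIsoToRingEquiv : _ →+* R s.B).comp
      (Scheme.ΓSpecIso (CommRingCat.of (R s.B))).inv.hom = RingHom.id _ :=
    RingHom.ext fun x => Iso.inv_hom_id_apply (Scheme.ΓSpecIso (CommRingCat.of (R s.B))) x
  rw [this, Ideal.map_id]

/-- [OURS] The cone of the single chart is `B`. -/
theorem chart₀_cone : (chart₀ s).cone = s.B := by
  unfold Chart.cone chart₀
  simp

/-- [OURS] The single chart's exponent map is `expOn`. -/
theorem chart₀_expOf (α : ℕ →₀ ℕ) : (chart₀ s).expOf α = expOn s.B α := by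
  ext b; rfl

/-- [OURS] The single chart reads the monomial ideal as `genIdeal`. -/
theorem chart₀_monIdeal : (chart₀ s).monIdeal s.A = genIdeal s := by
  unfold Chart.monIdeal genIdeal genMonomial
  congr 1
  exact Set.image_congr fun α _ => by rw [chart₀_expOf]

variable {s} (hs : s.WF) (hstr : s.Str = s.B.powerset) {m : ℕ} (hm : 1 ≤ m)
include hs hstr hm

/-- [OURS · W5.2 M2-strong · Route K, K17] **The invariant at level zero**: for a well-formed simplex state,
the affine space with its coordinate hyperplanes, the marked monomial ideal `(I, m)`, Kollár's functorial
sequence and the single chart satisfy `Good`. -/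
theorem good_levelZero :
    ∃ (𝔱 : CentreSeq (affine s.B)), Good s.B m s (affine s.B) (D₀ s) ((triple₀ hs).marked m) 𝔱 {chart₀ s} := by
  classical
  obtain ⟨B, hres, hne, hcomm⟩ := exists_functorial_resolution₀ hs hm
  refine ⟨B (triple₀ hs), ?_⟩
  have himg_D : ∀ b : s.B, (chart₀ s).img (D₀ s ((chart₀ s).lab b)) = Ideal.span {MvPolynomial.X b} := by
    intro b
    change (chart₀ s).img (D₀ s b) = _
    rw [D₀, dif_pos b.2]
    exact chart₀_img_idealSheaf s _
  exact
  { locNoeth := inferInstance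
    mult := rfl
    res := hres
    noEmpty := hne
    D_top := fun l hl => by rw [D₀, dif_neg hl]
    lab_inj := fun c hc => by
      rw [Set.mem_singleton_iff] at hc; subst hc
      exact fun _ _ _ _ h => h
    cone_mem := fun c hc => by
      rw [Set.mem_singleton_iff] at hc; subst hc
      rw [chart₀_cone, hstr, Finset.mem_powerset]
    cov_str := fun T hT => ⟨chart₀ s, rfl, by rw [chart₀_cone]; exact hs.str_subset T hT⟩
    cov_pts := fun y => ⟨chart₀ s, rfl, trivial⟩
    img_D := fun c hc b => by
      rw [Set.mem_singleton_iff] at hc; subst hc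
      exact himg_D b
    img_D_top := fun c hc l hl => by
      rw [Set.mem_singleton_iff] at hc; subst hc
      rw [chart₀_cone] at hl
      rw [D₀, dif_neg hl, Chart.img_top]
    img_M := fun c hc => by
      rw [Set.mem_singleton_iff] at hc; subst hc
      change (chart₀ s).img (ideal₀ s) = _
      rw [ideal₀, chart₀_img_idealSheaf, chart₀_monIdeal]
    mem_U_iff := fun c hc y => by
      rw [Set.mem_singleton_iff] at hc; subst hc
      constructor
      · intro _ l hl
        rw [chart₀_cone]
        by_contra h
        rw [D₀, dif_neg h, Scheme.IdealSheafData.support_top] at hl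
        exact hl
      · intro _; trivial
    sym := fun c hc t ht => by
      rw [Set.mem_singleton_iff] at hc; subst hc
      refine ⟨scale t ht, le_top, fun f => ?_, selfPullback₀ hs hcomm t ht, fun l => ?_⟩
      · -- the action on global sections is `scaleHom t`
        have h2 : ∀ e, (scale t ht).hom.appLE (⊤ : (affine s.B).Opens) ⊤ e = (scale t ht).hom.appTop := by
          intro e
          rw [Scheme.Hom.appTop, Scheme.Hom.app_eq_appLE]
          rfl
        change (Scheme.ΓSpecIso (CommRingCat.of (R s.B))).hom (((scale t ht).hom.appLE ⊤ ⊤ _).hom f) =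
          scaleHom t ((Scheme.ΓSpecIso (CommRingCat.of (R s.B))).hom f)
        rw [h2, scale_hom', ← CommRingCat.comp_apply, Scheme.ΓSpecIso_naturality, CommRingCat.comp_apply]
        rfl
      · by_cases hl : l ∈ s.B
        · rw [D₀, dif_pos hl, scale_hom', affineBlowup.comap_idealSheaf_specMap, Ideal.map_span, Set.image_singleton]
          change affineBlowup.idealSheaf (Ideal.span {scaleHom t (MvPolynomial.X ⟨l, hl⟩)}) = _
          rw [scaleHom_X, Ideal.span_singleton_mul_left_unit]
          exact (isUnit_iff_ne_zero.mpr (ht ⟨l, hl⟩)).map MvPolynomial.C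
        · rw [D₀, dif_neg hl, Scheme.IdealSheafData.comap_top] }

end LevelZero

end RouteK

end PolyhedraGame

end Summit.ResolutionOfSingularities.ResolutionOfSingularities.Theorems

end
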